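import Summits.QuantumFields.BalabanUV.T4Continuum.Support.ShellMeasureDecayComplexRay
import Summits.QuantumFields.BalabanUV.Beta.MultiscaleCombesThomasL2Cells

/-!
# `T4Continuum.ShellMeasureDecayComplexRayCells` — ROW S121 (J6) file 4: THE E6 ROW SHAPE ALONG THE COMPLEX RAY — the CELL-TO-CELL
# ℓ²-operator bound `‖1_{cell k}(cmat levelOp + P)⁻¹1_{cell k′}‖ ≤ e^{−κ(d_n(t_k,t_{k′}) − 4d)}·S_{l_k}S_{l_{k′}}∕((1 − θ)μ₀)` for a
# re-nonnegative complex remainder under the sitewise budget (the (3.46)₁-SHAPE of `Beta/MultiscaleCombesThomasL2Cells`, complexified)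
(cell `pub-balaban`, sub-cell `t4`, spine estimate NE7c (node U5b); NE7c ROUND-2 crew `t4-ne7c-formalise-*`, unit
`b2b-balaban-t4-ne7c-formalise-leaf-10` gen 15; owner table `t4/b2b-balaban-t4-ne7c-p1/LEAVES-NE7c-P1.md` ROW **S121 = J6** (GO R-ne7cp1-g37-10 (b)),
file 4 over file 1 `ShellMeasureDecayComplexRay` (p243718 ✓) and `Beta/MultiscaleCombesThomasL2Cells` (`set_norm_inv_le`, `sdist_corner_thresholds`);
ADDITIVE — imports those two ONLY; [folklore]; theorems only, 0 `def`, 0 `def … : Prop`, 0 sorry, 0 citation tags; touches NO host; moves NO census row)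

HONEST FRAMING.  Finite four-torus programme, rung (B)+1 only — NOT infinite volume, NOT a mass gap, NOT the Clay problem, NOT summit
progress; (B), `BetaPertHyp`, (B^μ) not consumed.  NE7c (`T4IndicatorShell.ShellWeightBound` for the cell's expansions) is NOT PRINTED in
[Balaban 1983–89] and NOT PROVED; «NE7c ⇐ the named binders» (trigger c3).  This file composes beta-an4's ℓ²-localized engine
(`MultiscaleCombesThomasL2.set_norm_inv_le`, for ANY complex matrix with a sitewise conjugated-coercivity profile) with file 1's re-nonnegative
remainder clause and beta-d4-p2's `hc_levelOp`, all BY NAME, on OUR torus MODEL; `P`, `hP`, `hJ` are DISPLAYED; nothing of Bałaban's is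
asserted, cited or discharged; the identification of the ONE CALL's decay rows `hk𝒢 hkι hkH hkH₁` with such cell blocks is ROW S118 (J3)'s
∕ node O's business, not claimed here.  HONEST DEPENDENCY (cell): continuum YM on T⁴ ⇐ BetaPertH ∧ nine spine estimates (0/9 proved);
BetaPertH ⇐ (D1) ∧ (D4) ∧ CAP+tail; G-an2-4 gates asym, D1 and NE2/3/4.

THE POINT.  ROW S118 (J3, leaf-02-g13) typed the E6 row SHAPE `‖k V c b′‖ ≤ c𝒢·e^{−δ·dis(c,b′)}` for the REAL model operator from
`MultiscaleCombesThomasL2Cells.real_cellNorm_levelOp_inverse_le`.  Along the complex contraction ray the operator is `cmat levelOp + P`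
(file 1); the ℓ²-localized engine is already complex, so the same cell-to-cell bound holds with the profile `(1 − θ)·μ₀·n⁻²`:
**`cellNorm_inv_add_complexRay_le`** — for data `v` supported in cell `k′`,
`√(Σ_{cell k}‖((cmat levelOp + P)⁻¹v)_p‖²) ≤ e^{−κ·(d_n(t_k,t_{k′}) − 2d − 2d)}∕√(((1−θ)μ₀S_{l_k}⁻²)((1−θ)μ₀S_{l_{k′}}⁻²))·√(Σ_{cell k′}‖v_p‖²)`
(thresholds `sdist_corner_thresholds`: the source cell oscillates by `≤ 2d`, the target cell sits `≥ d_n(t_k,t_{k′}) − 2d` away) — i.e.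
`‖1_k(·)⁻¹1_{k′}‖_{ℓ²→ℓ²} ≤ e^{4dκ}·S_{l_k}S_{l_{k′}}∕((1−θ)μ₀)·e^{−κ·d_n(t_k,t_{k′})}`, the E6 shape with ONE constant per pair of levels.
NOT claimed: the one-prefactor∕graded transfer (`…L2CellsGraded`), the Dirichlet-sectioned twin (file 3 + J3 f2's `real_cellNorm_dirInv_le`
pattern — one more composition), sup members, anything of Bałaban's.
-/

noncomputable section

open scoped BigOperators Matrix ComplexConjugate
open Finset Function Complex Matrix

namespace Summit.QuantumFields.BalabanUV.T4Continuum.ShellMeasureDecayComplexRayCells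

open Summit.QuantumFields.BalabanUV.Beta
open Summit.QuantumFields.BalabanUV.Beta.BoxPoincare (Box)
open Summit.QuantumFields.BalabanUV.Beta.MultiscaleCoerciveTorus
open Summit.QuantumFields.BalabanUV.Beta.MultiscaleDecayBudget (siteScale one_le_siteScale cellOf)
open Summit.QuantumFields.BalabanUV.Beta.MultiscaleDistance (sdist sdist_self)
open Summit.QuantumFields.BalabanUV.Beta.MultiscaleDecay (hc_levelOp)
open Summit.QuantumFields.BalabanUV.Beta.MultiscaleCombesThomasL2 (set_norm_inv_le)
open Summit.QuantumFields.BalabanUV.Beta.AccretiveCombesThomasSandwichSite (sdist_corner_thresholds)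
open Summit.QuantumFields.BalabanUV.Beta.AccretiveCombesThomas (conjForm)
open Summit.QuantumFields.BalabanUV.Beta.AccretiveCombesThomasBudget (expRowDefect expColDefect)
open Summit.QuantumFields.BalabanUV.Beta.MultiscaleCombesThomasBudget (localConjCoercive_of_real realConjForm realConjForm_toMatrix')
open Summit.QuantumFields.BalabanUV.Beta.CovariantTowerMatrix (cmat)
open Summit.QuantumFields.BalabanUV.T4Continuum.ShellMeasureDecayComplexRay (localConjCoercive_add_of_re_nonneg_budget)
open Literature.MathematicalPhysics.QuantumFieldTheory.Balaban1983to89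
open Literature.MathematicalPhysics.QuantumFieldTheory.Balaban1983to89.B9Thm37GluePU (bsrc btgt)
open Literature.MathematicalPhysics.QuantumFieldTheory.Balaban1983to89.B9Thm37GlueTorusCov (tblk)
open Literature.MathematicalPhysics.QuantumFieldTheory.Balaban1983to89.B9Thm37GlueTorusCovLevels (levelOp)
open B5TorusCover (UT Ctr ctrU)

variable {d : ℕ} {N : Fin d → ℕ} [∀ i, NeZero (N i)] [NeZero d] {Cp J K : Type} [Fintype Cp] [DecidableEq Cp] [Nonempty Cp]
  [Fintype J] [Fintype K] [DecidableEq K]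
  (S : J → ℕ) (hS : ∀ l, 1 ≤ S l) (hdivS : ∀ l i, S l ∣ N i) (lvl : K → J) (zc : (k : K) → Ctr N (S (lvl k)))

/-- **THE CELL-TO-CELL ℓ² BOUND ALONG THE COMPLEX RAY (MODEL; the E6 row shape, complexified).**  Setting of `MultiscaleDecay.decay_levelOp` +
a complex remainder `P` with `Re z^*Pz ≥ 0` and the sitewise budget `½(expRowDefect + expColDefect)(P; κ, d_n(·,q₁))(e) ≤ θ·μ₀·n(e₁)⁻²`
(`θ < 1`).  For cells `k, k′` and complex data `v` supported in cell `k′`: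
`√(Σ_{p ∈ cell k}‖((cmat levelOp + P)⁻¹ v)_p‖²) ≤ e^{−κ(d_n(t_k,t_{k′}) − 2d − 2d)}∕√(((1−θ)μ₀S_{l_k}⁻²)·((1−θ)μ₀S_{l_{k′}}⁻²))·√(Σ_{p ∈ cell k′}‖v_p‖²)`.
[folklore] -/
theorem cellNorm_inv_add_complexRay_le
    (hdisj : ∀ k k' v v', cellPt S hS hdivS lvl zc k v = cellPt S hS hdivS lvl zc k' v' → k = k')
    (hcover : ∀ x : UT N, ∃ k, ∃ v : Box d (S (lvl k)), cellPt S hS hdivS lvl zc k v = x)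
    (Rm : UT N × Fin d → Cp → Cp → ℝ) (hRm : ∀ b i j, ∑ k, Rm b k i * Rm b k j = if i = j then (1 : ℝ) else 0)
    (T : J → UT N → Cp → Cp → ℝ) (hT : ∀ l x i i', ∑ k, T l x k i * T l x k i' = if i = i' then (1 : ℝ) else 0)
    (a : J → ℝ) (ha : ∀ j, 0 ≤ a j) (ω : J → UT N → ℝ)
    (hsupp : ∀ l x, ω l (ctrU N (S l) (tblk (hS l) (hdivS l) x)) ≠ 0 → ∃ k v, lvl k = l ∧ cellPt S hS hdivS lvl zc k v = x)
    {amax : ℝ} (hamax : 0 ≤ amax)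
    (hscale : ∀ k, a (lvl k) * ω (lvl k) (ctrU N (S (lvl k)) (zc k)) ^ 2 * (S (lvl k) : ℝ) ^ d ≤ amax / (S (lvl k) : ℝ) ^ 2)
    (c : UT N × Fin d → ℝ) {cmax : ℝ} (hc : ∀ b, |c b| ≤ cmax) {C : ℝ}
    (hcoer : ∀ f : UT N × Cp → ℝ,
      C * ∑ k, ((S (lvl k) : ℝ) ^ 2)⁻¹ * ∑ v : Box d (S (lvl k)), ∑ i, f (cellPt S hS hdivS lvl zc k v, i) ^ 2 ≤
        ∑ p, f p * levelOp bsrc btgt c Rm (fun l x => ctrU N (S l) (tblk (hS l) (hdivS l) x))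
          (fun l x => ω l (ctrU N (S l) (tblk (hS l) (hdivS l) x))) T a f p)
    {κ : ℝ} (hκ0 : 0 ≤ κ) (hκ1 : κ ≤ 1) (hμ : 0 < C - 2 * d * cmax ^ 2 * κ ^ 2 - amax * (Real.exp (2 * d * κ) - 1))
    (P : Matrix (UT N × Cp) (UT N × Cp) ℂ) (hP : ∀ z, 0 ≤ (star z ⬝ᵥ (P *ᵥ z)).re) {θ : ℝ} (hθ : θ < 1)
    (hJ : ∀ q e : UT N × Cp,
      (expRowDefect P κ (fun e => sdist bsrc btgt (siteScale S hS hdivS lvl zc hcover) e.1 q.1) e +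
          expColDefect P κ (fun e => sdist bsrc btgt (siteScale S hS hdivS lvl zc hcover) e.1 q.1) e) / 2 ≤
        θ * ((C - 2 * d * cmax ^ 2 * κ ^ 2 - amax * (Real.exp (2 * d * κ) - 1)) *
          ((siteScale S hS hdivS lvl zc hcover e.1 : ℝ) ^ 2)⁻¹))
    (k k' : K) (v : UT N × Cp → ℂ) (hv : ∀ p, cellOf S hS hdivS lvl zc hcover p.1 ≠ k' → v p = 0) :
    Real.sqrt (∑ p ∈ univ.filter (fun p : UT N × Cp => cellOf S hS hdivS lvl zc hcover p.1 = k),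
        ‖((cmat (levelOp bsrc btgt c Rm (fun l x => ctrU N (S l) (tblk (hS l) (hdivS l) x))
            (fun l x => ω l (ctrU N (S l) (tblk (hS l) (hdivS l) x))) T a) + P)⁻¹ *ᵥ v) p‖ ^ 2) ≤
      Real.exp (-(κ * (sdist bsrc btgt (siteScale S hS hdivS lvl zc hcover) (ctrU N (S (lvl k)) (zc k))
          (ctrU N (S (lvl k')) (zc k')) - 2 * d - 2 * d))) /
        Real.sqrt ((1 - θ) * (C - 2 * d * cmax ^ 2 * κ ^ 2 - amax * (Real.exp (2 * d * κ) - 1)) * ((S (lvl k) : ℝ) ^ 2)⁻¹ *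
          ((1 - θ) * (C - 2 * d * cmax ^ 2 * κ ^ 2 - amax * (Real.exp (2 * d * κ) - 1)) * ((S (lvl k') : ℝ) ^ 2)⁻¹)) *
        Real.sqrt (∑ p ∈ univ.filter (fun p : UT N × Cp => cellOf S hS hdivS lvl zc hcover p.1 = k'), ‖v p‖ ^ 2) := by
  classical
  obtain ⟨i₀⟩ := ‹Nonempty Cp›
  set μ₀ := C - 2 * d * cmax ^ 2 * κ ^ 2 - amax * (Real.exp (2 * d * κ) - 1) with hμ₀
  set n := siteScale S hS hdivS lvl zc hcover with hn
  set A := levelOp bsrc btgt c Rm (fun l x => ctrU N (S l) (tblk (hS l) (hdivS l) x))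
    (fun l x => ω l (ctrU N (S l) (tblk (hS l) (hdivS l) x))) T a with hA
  set tk' : UT N := ctrU N (S (lvl k')) (zc k') with htk'
  have h1θ : 0 < 1 - θ := by linarith
  have hn0 : ∀ x, (0 : ℝ) < n x := fun x => by exact_mod_cast one_le_siteScale S hS hdivS lvl zc hcover x
  have hSpos : ∀ l, (0 : ℝ) < (S l : ℝ) := fun l => by exact_mod_cast hS l
  -- the sitewise profile of the complexified operator along the weight `κ·d_n(·, t_{k′})`
  set μ : UT N × Cp → ℝ := fun e => μ₀ * ((n e.1 : ℝ) ^ 2)⁻¹ with hμdef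
  set ρ : UT N × Cp → ℝ := fun e => sdist bsrc btgt n e.1 tk' with hρ
  have hcR : ∀ w : UT N × Cp → ℝ, ∑ e, μ e * w e ^ 2 ≤ realConjForm (LinearMap.toMatrix' A) κ ρ w := by
    intro w
    rw [realConjForm_toMatrix']
    have h := hc_levelOp S hS hdivS lvl zc hdisj hcover Rm hRm T hT a ha ω hsupp hamax hscale c hc hcoer hκ0 hκ1 (tk', i₀) w
    refine le_trans (le_of_eq (Finset.sum_congr rfl fun e _ => ?_)) h
    rw [hμdef]
  have hcA : ∀ z : UT N × Cp → ℂ, ∑ e, μ e * ‖z e‖ ^ 2 ≤ (conjForm (cmat A) κ ρ z).re :=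
    fun z => localConjCoercive_of_real _ hcR z
  have hcAP : ∀ z : UT N × Cp → ℂ, ∑ e, (1 - θ) * μ e * ‖z e‖ ^ 2 ≤ (conjForm (cmat A + P) κ ρ z).re :=
    fun z => localConjCoercive_add_of_re_nonneg_budget hcA hP (fun e => hJ (tk', i₀) e) z
  have hμ' : ∀ e, 0 < (1 - θ) * μ e := fun e => mul_pos h1θ (mul_pos hμ (inv_pos.mpr (pow_pos (hn0 e.1) 2)))
  have hthr := sdist_corner_thresholds S hS hdivS lvl zc hdisj hcover
  -- the ℓ²-localized engine
  have h := set_norm_inv_le (A := cmat A + P) hμ' hκ0 (fun z => by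
      have := hcAP z
      refine le_trans (le_of_eq (Finset.sum_congr rfl fun e _ => by ring)) this)
    (univ.filter (fun p : UT N × Cp => cellOf S hS hdivS lvl zc hcover p.1 = k))
    (univ.filter (fun p : UT N × Cp => cellOf S hS hdivS lvl zc hcover p.1 = k'))
    (fun p hp => hv p (fun h => hp (mem_filter.mpr ⟨mem_univ _, h⟩)))
    (R := sdist bsrc btgt n (ctrU N (S (lvl k)) (zc k)) tk' - 2 * d) (ω := 2 * d)
    (mul_pos h1θ (mul_pos hμ (inv_pos.mpr (pow_pos (hSpos (lvl k)) 2))))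
    (mul_pos h1θ (mul_pos hμ (inv_pos.mpr (pow_pos (hSpos (lvl k')) 2))))
    (fun p hp => ?_) (fun p hp => ?_) (fun p hp => ?_) (fun p hp => ?_)
  · have ex : (1 - θ) * (μ₀ * ((S (lvl k) : ℝ) ^ 2)⁻¹) * ((1 - θ) * (μ₀ * ((S (lvl k') : ℝ) ^ 2)⁻¹)) =
        (1 - θ) * μ₀ * ((S (lvl k) : ℝ) ^ 2)⁻¹ * ((1 - θ) * μ₀ * ((S (lvl k') : ℝ) ^ 2)⁻¹) := by ring
    rw [ex] at h
    exact h
  · -- target floor on cell `k`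
    have hpk : cellOf S hS hdivS lvl zc hcover p.1 = k := (mem_filter.mp hp).2
    have h2 := (hthr p.1 k').2
    rw [hpk] at h2
    exact h2
  · -- source oscillation on cell `k′`
    exact (hthr p.1 k').1 (mem_filter.mp hp).2
  · -- profile on cell `k`
    have hpk : cellOf S hS hdivS lvl zc hcover p.1 = k := (mem_filter.mp hp).2
    have hnp : n p.1 = S (lvl k) := by rw [hn, siteScale, hpk]
    show (1 - θ) * (μ₀ * ((S (lvl k) : ℝ) ^ 2)⁻¹) ≤ (1 - θ) * (μ₀ * ((n p.1 : ℝ) ^ 2)⁻¹)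
    rw [hnp]
  · have hpk : cellOf S hS hdivS lvl zc hcover p.1 = k' := (mem_filter.mp hp).2
    have hnp : n p.1 = S (lvl k') := by rw [hn, siteScale, hpk]
    show (1 - θ) * (μ₀ * ((S (lvl k') : ℝ) ^ 2)⁻¹) ≤ (1 - θ) * (μ₀ * ((n p.1 : ℝ) ^ 2)⁻¹)
    rw [hnp]

end Summit.QuantumFields.BalabanUV.T4Continuum.ShellMeasureDecayComplexRayCells

end
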